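import Literature.Combinatorics.SimpleGraph.TreeRetractionOntoSubtree   -- ★ `TreeRetraction.exists_retraction` (the data `(h, p)` whose clauses are the hypotheses below)
import HarnessLib

/-!
# The ROOT of a vertex under the retraction onto a subtree is a GATE: `dist(v, y) = h(v) + dist(ρ v, y)` for `y ∈ Y`; cones and their equivariance (Serre, *Trees* I.2.3)

Topic `Combinatorics/SimpleGraph`; namespace `Literature.Combinatorics.SimpleGraph.TreeLayers` (family of ★ `TreeSubtreeLayerCount` ∕ `TreeHereditaryLayerCount`).  THEOREMS ONLY (no
definition, no instance, no notation, no named fact, no `sorry`); Mathlib + ★ `TreeRetractionOntoSubtree`; arbitrary vertex type.  Cell `pub/hodgecm-mathlib`, F0∕P3a, crux H413 =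
`stmt-HodgeConjecture-24833`, road «S3-tree», brick T2-S «apartment ∕ tube per period» (HANDOFF-T2S-fold fbca9750 §2 (b)∕(e), F0P2-p02 (g10) → F0P2-p06 (g10); split agreed with
F0P2-p02 (g11) 17:51:39Z: the transversal law (d) is theirs, this generic cone bookkeeping is the «tree organs» hand's).  HONEST LABEL: HC_CM is proved only modulo the printed
citations (the 2 remaining named inputs hLiu418, h413) until rung 0 closes; pure graph theory here.

THE MATHEMATICS ([Serre1980Trees] I.2.3).  `G` connected, `Y ⊆ V`, `(h, p)` height∕parent data toward `Y` — used through the clauses (P1) `h v = 0 ↔ v ∈ Y`, (P2) `v ∉ Y ⇒ v ~ p v ∧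
h (p v) + 1 = h v`, (P5) `v ∉ Y ⇒` every neighbour `w ≠ p v` has `h w = h v + 1 ∧ p w = v`, (dist) `h v = min_{y ∈ Y} dist(v, y)` (attained), (P4) equivariance — all clauses of
★ `exists_retraction`, taken as hypotheses.  The ROOT of `v` is the iterated parent `ρ v := p^[h v] v` (no definition is introduced: the statements spell `p^[h v] v`).
* §1 `height_iterate_parent` (`h (p^[k] v) = h v − k`), `iterate_parent_height_mem` (`ρ v ∈ Y`), `iterate_parent_height_eq_self_of_mem` (`ρ v = v` on `Y`),
  `iterate_parent_height_parent` (`ρ (p v) = ρ v` off `Y` — the root predicate is hereditary, cf. ★ `iterate_parent_hereditary`), `exists_walk_iterate_parent` ∕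
  `dist_iterate_parent_height_le` (`dist(v, ρ v) ≤ h v`), `dist_iterate_parent_height_eq` (`= h v` under (dist)).
* §2 **`height_add_dist_root_le_dist`** ∕ **`dist_eq_height_add_dist_root`** — THE GATE PROPERTY: for `y ∈ Y`, `dist(v, y) = h v + dist(ρ v, y)` (strong induction on `dist(v, y)`:
  the first edge of a geodesic from `v ∉ Y` goes to the parent or to a child, and (P5) controls both); **`iterate_parent_height_eq_of_dist_eq_height`** — the nearest point of `Y` is
  UNIQUE: `y ∈ Y`, `dist(v, y) = h v ⇒ ρ v = y`.
* §3 CONES `{v | ρ v = y}` and equivariance: `iterate_parent_equivariant` (`p^[k] (φ v) = φ (p^[k] v)` for `k ≤ h v`, `φ` a `Y`-preserving automorphism with (P4)),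
  **`root_equivariant`** (`ρ (φ v) = φ (ρ v)`), `setOf_root_mem_eq_biUnion` (`{v | ρ v ∈ D} = ⋃_{y ∈ D} {v | ρ v = y}`), `image_cone_eq` (`φ '' cone(y) = cone(φ y)`): the cones
  over a fundamental domain `D ⊆ Y` of a translation are a fundamental domain for it on `V` — the per-period bookkeeping of the tube fold.

## References
* [Serre1980Trees] J.-P. Serre, *Trees*, Springer (1980): I.2.3 (projection onto a subtree: every geodesic from `v` into `Y` passes through the projection of `v`), I.6.4.
* [Diestel2010] R. Diestel, *Graph Theory*, 4th ed., Thm. 1.5.1.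
-/

set_option autoImplicit false

open SimpleGraph

namespace Literature.Combinatorics.SimpleGraph.TreeLayers

variable {V : Type*} {G : SimpleGraph V}

section Gate

variable {Y : Set V} {h : V → ℕ} {p : V → V}
  (h0 : ∀ v, h v = 0 ↔ v ∈ Y) (hpar : ∀ v, v ∉ Y → G.Adj v (p v) ∧ h (p v) + 1 = h v)
  (hchild : ∀ v w, v ∉ Y → G.Adj v w → w ≠ p v → h w = h v + 1 ∧ p w = v)

/-! ## §1 Iterated parents and the root `p^[h v] v` -/

include h0 hpar in
/-- Heights along the descent: `h (p^[k] v) = h v − k` for `k ≤ h v`. [cite: Serre1980Trees, I.2.3] -/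
theorem height_iterate_parent (v : V) : ∀ k, k ≤ h v → h (p^[k] v) = h v - k := by
  intro k
  induction k with
  | zero => intro _; rw [Function.iterate_zero_apply, Nat.sub_zero]
  | succ k ih =>
    intro hk
    have hk' : h (p^[k] v) = h v - k := ih (Nat.le_of_succ_le hk)
    have hnot : p^[k] v ∉ Y := fun hmem => by
      have := (h0 _).2 hmem
      omega
    have := (hpar _ hnot).2
    rw [Function.iterate_succ_apply']
    omega

include h0 hpar in
/-- **The root lies in `Y`**: `p^[h v] v ∈ Y`. [cite: Serre1980Trees, I.2.3] -/
theorem iterate_parent_height_mem (v : V) : p^[h v] v ∈ Y :=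
  (h0 _).1 (by have := height_iterate_parent h0 hpar v (h v) le_rfl; omega)

include h0 in
/-- On `Y` the root is the vertex itself. [cite: Serre1980Trees, I.2.3] -/
theorem iterate_parent_height_eq_self_of_mem {v : V} (hv : v ∈ Y) : p^[h v] v = v := by
  rw [(h0 v).2 hv, Function.iterate_zero_apply]

include hpar in
/-- **The root is constant along parent edges**: `p^[h (p v)] (p v) = p^[h v] v` for `v ∉ Y`. [cite: Serre1980Trees, I.2.3] -/
theorem iterate_parent_height_parent {v : V} (hv : v ∉ Y) : p^[h (p v)] (p v) = p^[h v] v := by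
  rw [← (hpar v hv).2, Function.iterate_succ_apply]

include h0 hpar in
/-- A walk of length `k` from `v` down to `p^[k] v` (`k ≤ h v`). [cite: Serre1980Trees, I.2.3] -/
theorem exists_walk_iterate_parent : ∀ (k : ℕ) (v : V), k ≤ h v → ∃ W : G.Walk v (p^[k] v), W.length = k := by
  intro k
  induction k with
  | zero => intro v _; exact ⟨(Walk.nil : G.Walk v v).copy rfl (Function.iterate_zero_apply p v).symm, by rw [Walk.length_copy, Walk.length_nil]⟩
  | succ k ih =>
    intro v hk
    have hv : v ∉ Y := fun hmem => by have := (h0 v).2 hmem; omega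
    obtain ⟨hadj, hh⟩ := hpar v hv
    obtain ⟨W, hW⟩ := ih (p v) (by omega)
    refine ⟨(Walk.cons hadj W).copy rfl (Function.iterate_succ_apply p k v).symm, ?_⟩
    rw [Walk.length_copy, Walk.length_cons, hW]

include h0 hpar in
/-- `dist(v, ρ v) ≤ h v`. [cite: Serre1980Trees, I.2.3] -/
theorem dist_iterate_parent_height_le (v : V) : G.dist v (p^[h v] v) ≤ h v := by
  obtain ⟨W, hW⟩ := exists_walk_iterate_parent h0 hpar (h v) v le_rfl
  calc G.dist v (p^[h v] v) ≤ W.length := dist_le W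
    _ = h v := hW

include h0 hpar in
/-- Under the distance clause of ★ `exists_retraction`, `dist(v, ρ v) = h v` (the root attains the height). [cite: Serre1980Trees, I.2.3] -/
theorem dist_iterate_parent_height_eq (hdist : ∀ v, (∃ y ∈ Y, G.dist v y = h v) ∧ ∀ y ∈ Y, h v ≤ G.dist v y) (v : V) : G.dist v (p^[h v] v) = h v :=
  le_antisymm (dist_iterate_parent_height_le h0 hpar v) ((hdist v).2 _ (iterate_parent_height_mem h0 hpar v))

/-! ## §2 The gate property -/

include h0 hpar hchild in
/-- **`h v + dist(ρ v, y) ≤ dist(v, y)` for `y ∈ Y`** (`G` connected): strong induction on `dist(v, y)` — for `v ∉ Y` a geodesic to `y` starts with an edge `v ~ w`; if `w = p v` the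
induction hypothesis at `w` gives equality, and if `w` is a child then `ρ w = ρ v`, `h w = h v + 1` and the bound only improves. [cite: Serre1980Trees, I.2.3] -/
theorem height_add_dist_root_le_dist (hc : G.Connected) {y : V} (hy : y ∈ Y) : ∀ (n : ℕ) (v : V), G.dist v y = n → h v + G.dist (p^[h v] v) y ≤ n := by
  intro n
  induction n using Nat.strong_induction_on with
  | _ n ih =>
    intro v hv
    by_cases hvY : v ∈ Y
    · rw [(h0 v).2 hvY, Function.iterate_zero_apply, zero_add, hv]
    · -- `v ≠ y`, so a geodesic from `v` to `y` has a first edge `v ~ w`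
      have hne : v ≠ y := fun heq => hvY (heq ▸ hy)
      obtain ⟨W, hW⟩ := hc.exists_walk_length_eq_dist v y
      cases W with
      | nil => exact absurd rfl hne
      | @cons _ w _ hadj W' =>
        rw [Walk.length_cons] at hW
        have hwy : G.dist w y ≤ W'.length := dist_le W'
        have htri : G.dist v y ≤ G.dist v w + G.dist w y := hc.dist_triangle
        have hvw : G.dist v w ≤ 1 := by
          have := dist_le (Walk.cons hadj Walk.nil)
          rwa [Walk.length_cons, Walk.length_nil] at this
        have hdw : G.dist w y = n - 1 := by omega
        have hn : 1 ≤ n := by omega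
        have key := ih (n - 1) (by omega) w hdw
        by_cases hwp : w = p v
        · -- the parent: `h w = h v − 1`, same root
          subst hwp
          have hh := (hpar v hvY).2
          rw [iterate_parent_height_parent hpar hvY] at key
          omega
        · -- a child: `h w = h v + 1`, `p w = v`, same root
          obtain ⟨hh, hpw⟩ := hchild v w hvY hadj hwp
          have hwY : w ∉ Y := fun hmem => by have := (h0 w).2 hmem; omega
          have hroot : p^[h w] w = p^[h v] v := by
            rw [← iterate_parent_height_parent hpar hwY, hpw]
          rw [hroot] at key
          omega

include h0 hpar hchild in
/-- **THE GATE PROPERTY** ([Serre1980Trees] I.2.3: every geodesic from `v` into the subtree passes through the projection of `v`): for `y ∈ Y`,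
`dist(v, y) = h v + dist(p^[h v] v, y)` (`G` connected). [cite: Serre1980Trees, I.2.3] -/
theorem dist_eq_height_add_dist_root (hc : G.Connected) {y : V} (hy : y ∈ Y) (v : V) : G.dist v y = h v + G.dist (p^[h v] v) y := by
  refine le_antisymm ?_ (height_add_dist_root_le_dist h0 hpar hchild hc hy (G.dist v y) v rfl)
  calc G.dist v y ≤ G.dist v (p^[h v] v) + G.dist (p^[h v] v) y := hc.dist_triangle
    _ ≤ h v + G.dist (p^[h v] v) y := by have := dist_iterate_parent_height_le h0 hpar v (G := G); omega

include h0 hpar hchild in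
/-- **The nearest point of `Y` is unique**: if `y ∈ Y` and `dist(v, y) = h v` then `y` is the root `p^[h v] v`. [cite: Serre1980Trees, I.2.3] -/
theorem iterate_parent_height_eq_of_dist_eq_height (hc : G.Connected) {y v : V} (hy : y ∈ Y) (hd : G.dist v y = h v) : p^[h v] v = y := by
  have hgate := dist_eq_height_add_dist_root h0 hpar hchild hc hy v
  have h0d : G.dist (p^[h v] v) y = 0 := by omega
  exact (hc.dist_eq_zero_iff).1 h0d

include h0 hpar hchild in
/-- The height is the distance to the root, and every other point of `Y` is STRICTLY farther unless it is the root. [cite: Serre1980Trees, I.2.3] -/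
theorem height_lt_dist_of_ne_root (hc : G.Connected) {y v : V} (hy : y ∈ Y) (hne : p^[h v] v ≠ y) : h v < G.dist v y := by
  have hgate := dist_eq_height_add_dist_root h0 hpar hchild hc hy v
  have hpos : G.dist (p^[h v] v) y ≠ 0 := fun h0d => hne ((hc.dist_eq_zero_iff).1 h0d)
  omega

/-! ## §3 Cones and equivariance -/

include h0 in
/-- **Equivariance of iterated parents**: for an automorphism `φ` preserving `Y` with `h ∘ φ = h` and `p (φ v) = φ (p v)` off `Y` (★ clause (P4)), `p^[k] (φ v) = φ (p^[k] v)` for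
`k ≤ h v`. [cite: Serre1980Trees, I.6.4 Prop. 24] -/
theorem iterate_parent_equivariant (φ : G ≃g G) (hequi : ∀ v, h (φ v) = h v ∧ (v ∉ Y → p (φ v) = φ (p v)))
    (hiter : ∀ (v : V) (k : ℕ), k ≤ h v → h (p^[k] v) = h v - k) (v : V) : ∀ k, k ≤ h v → p^[k] (φ v) = φ (p^[k] v) := by
  intro k
  induction k with
  | zero => intro _; rw [Function.iterate_zero_apply, Function.iterate_zero_apply]
  | succ k ih =>
    intro hk
    have hk' := ih (Nat.le_of_succ_le hk)
    have hnot : p^[k] v ∉ Y := fun hmem => by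
      have h1 := (h0 _).2 hmem
      have h2 := hiter v k (Nat.le_of_succ_le hk)
      omega
    rw [Function.iterate_succ_apply', Function.iterate_succ_apply', hk', (hequi _).2 hnot]

include h0 hpar in
/-- **THE ROOT IS EQUIVARIANT**: `p^[h (φ v)] (φ v) = φ (p^[h v] v)` for a `Y`-preserving automorphism `φ` with (P4). Hence `φ` maps the cone `{w | ρ w = y}` onto the cone
`{w | ρ w = φ y}`, and the cones over a fundamental domain of a translation of `Y` form a fundamental domain on `V`. [cite: Serre1980Trees, I.6.4 Prop. 24] -/
theorem root_equivariant (φ : G ≃g G) (hequi : ∀ v, h (φ v) = h v ∧ (v ∉ Y → p (φ v) = φ (p v))) (v : V) :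
    p^[h (φ v)] (φ v) = φ (p^[h v] v) := by
  rw [(hequi v).1]
  exact iterate_parent_equivariant h0 φ hequi (fun v k hk => height_iterate_parent h0 hpar v k hk) v (h v) le_rfl

include h0 hpar in
/-- **Images of cones**: `φ '' {w | ρ w = y} = {w | ρ w = φ y}`. [cite: Serre1980Trees, I.6.4 Prop. 24] -/
theorem image_cone_eq (φ : G ≃g G) (hequi : ∀ v, h (φ v) = h v ∧ (v ∉ Y → p (φ v) = φ (p v))) (y : V) :
    φ '' {w | p^[h w] w = y} = {w | p^[h w] w = φ y} := by
  ext w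
  simp only [Set.mem_image, Set.mem_setOf_eq]
  constructor
  · rintro ⟨u, hu, rfl⟩
    rw [root_equivariant h0 hpar φ hequi u, hu]
  · intro hw
    refine ⟨φ.symm w, ?_, φ.apply_symm_apply w⟩
    apply φ.injective
    rw [← root_equivariant h0 hpar φ hequi (φ.symm w), RelIso.apply_symm_apply]
    exact hw

/-- Bookkeeping: the vertices rooted in `D` are the disjoint union of the cones over `D`. [cite: Serre1980Trees, I.2.3] -/
theorem setOf_root_mem_eq_biUnion (D : Set V) : {w | p^[h w] w ∈ D} = ⋃ y ∈ D, {w | p^[h w] w = y} := by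
  ext w
  simp only [Set.mem_setOf_eq, Set.mem_iUnion, exists_prop, exists_eq_right']

/-- Distinct roots give disjoint cones. [cite: Serre1980Trees, I.2.3] -/
theorem disjoint_cone_of_ne {y y' : V} (hne : y ≠ y') : Disjoint {w | p^[h w] w = y} {w | p^[h w] w = y'} := by
  rw [Set.disjoint_left]
  intro w hw hw'
  rw [Set.mem_setOf_eq] at hw hw'
  exact hne (hw.symm.trans hw')

end Gate

end Literature.Combinatorics.SimpleGraph.TreeLayers
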